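import Summits.AtomisticToContinuum.HydrodynamicLimit.Theorems.BoxDissipativeWeakStrongLocalGibbsFineScaleTreeL1
import Summits.AtomisticToContinuum.HydrodynamicLimit.Theorems.BoxDissipativeWeakStrongLocalGibbsFineScaleKernels
import Summits.AtomisticToContinuum.HydrodynamicLimit.Theorems.BoxDissipativeWeakStrongLocalGibbsFineScaleCgibbs

/-!
# `LocalGibbsFineScale` (route `BoxDissipativeWeakStrong`), file 7: the local Gibbs measure —
positions, velocities, parametric measurability

Support lemmas for item stmt-AtomisticToContinuum-9905: the measure-theoretic plumbing between the
local Gibbs measure `localGibbsMeasure σ a₀ u₀ θ₀ N` on phase space, its position marginal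
`posGibbsMeasure` (the canonical hard-sphere gas with activity `a₀`, which the tree identifies with
the conditioned product law of the profile `profileOf a₀`, `posGibbsMeasure_eq`) and the Gaussian
velocity law given the positions (`lintegral_localGibbsMeasure`):

* `lintegral_pos_localGibbsMeasure`: position functionals integrate against `posGibbsMeasure`;
* `lintegral_localGibbsMeasure_le_of_vel`: a conditional (velocity) bound `∫ G(q, v) dv ≤ b(q)`
  integrates to `∫⁻ G dP_N ≤ ∫⁻ b d(posGibbsMeasure)`;
* `integral_posGibbs_eq_cgibbs`, `integral_avg_posGibbs_eq_onePt`, `integral_avg_posGibbs_le`: the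
  bridge to the one-point expectation `E_{N+1}[g(q₀)] ≤ 2M` of the cluster expansion;
* joint measurability in (configuration, centre) of the empirical fields tested against a jointly
  measurable kernel (for Tonelli over the centre `x ∈ 𝕋³`).
-/

noncomputable section

namespace Summit.AtomisticToContinuum.HydrodynamicLimit.Theorems
namespace LGFS
open MeasureTheory ProbabilityTheory Finset Filter Topology Metric
open Literature.Probability.LatticeModels Literature.MathematicalPhysics.StatisticalMechanics
  Literature.MathematicalPhysics.KineticTheory
open Literature.Analysis.FluidPDE (Config)
open scoped ENNReal

variable {a₀ θ₀ : T3 → ℝ} {u₀ : T3 → V3}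

/-! ### Positions: the local Gibbs measure projects to `posGibbsMeasure` -/

/-- The position projection `z ↦ (i ↦ (z i).1)` is measurable. -/
theorem measurable_posProj (n : ℕ) : Measurable fun (z : Config n (Fin 3) T3) (i : Fin n) => (z i).1 :=
  measurable_pi_lambda _ fun i => (measurable_pi_apply i).fst

/-- **The position marginal of the local Gibbs measure is `posGibbsMeasure`** (as a push-forward). -/
theorem map_pos_localGibbsMeasure (ha : Continuous a₀) (hθ : Continuous θ₀) (hu : Continuous u₀)
    (ha0 : ∀ x, 0 ≤ a₀ x) (hθ0 : ∀ x, 0 < θ₀ x) (σ : ℝ) (N : ℕ) :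
    (localGibbsMeasure σ a₀ u₀ θ₀ N).map (fun z i => (z i).1) = posGibbsMeasure a₀ (hsDiameter σ N) (N + 1) := by
  ext S hS
  rw [Measure.map_apply (measurable_posProj (N + 1)) hS]
  exact localGibbsMeasure_preimage_pos ha hθ hu ha0 hθ0 σ N hS

/-- **Position functionals integrate against `posGibbsMeasure`.** -/
theorem lintegral_pos_localGibbsMeasure (ha : Continuous a₀) (hθ : Continuous θ₀) (hu : Continuous u₀)
    (ha0 : ∀ x, 0 ≤ a₀ x) (hθ0 : ∀ x, 0 < θ₀ x) (σ : ℝ) (N : ℕ) {G : (Fin (N + 1) → T3) → ℝ≥0∞}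
    (hG : Measurable G) :
    ∫⁻ z, G (fun i => (z i).1) ∂localGibbsMeasure σ a₀ u₀ θ₀ N =
      ∫⁻ q, G q ∂posGibbsMeasure a₀ (hsDiameter σ N) (N + 1) := by
  rw [← map_pos_localGibbsMeasure ha hθ hu ha0 hθ0 σ N, lintegral_map hG (measurable_posProj (N + 1))]

/-- **Integrating a conditional velocity bound**: if `∫⁻ G(zipConfig (q, v)) dv ≤ ofReal (b q)` for
all `q`, with `b` measurable, then `∫⁻ G dP_N ≤ ∫⁻ ofReal ∘ b d(posGibbsMeasure)`. -/
theorem lintegral_localGibbsMeasure_le_of_vel (ha : Continuous a₀) (hθ : Continuous θ₀)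
    (hu : Continuous u₀) (ha0 : ∀ x, 0 ≤ a₀ x) (hθ0 : ∀ x, 0 < θ₀ x) (σ : ℝ) (N : ℕ)
    {G : Config (N + 1) (Fin 3) T3 → ℝ≥0∞} (hG : Measurable G) {b : (Fin (N + 1) → T3) → ℝ}
    (hb : Measurable b) (hle : ∀ q, ∫⁻ v, G (zipConfig (q, v)) ∂velMeasure u₀ θ₀ q ≤ ENNReal.ofReal (b q)) :
    ∫⁻ z, G z ∂localGibbsMeasure σ a₀ u₀ θ₀ N ≤
      ∫⁻ q, ENNReal.ofReal (b q) ∂posGibbsMeasure a₀ (hsDiameter σ N) (N + 1) := by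
  have hfm : Measurable fun x : Fin (N + 1) → T3 =>
      ENNReal.ofReal ((posPartition a₀ (hsDiameter σ N) (N + 1))⁻¹ * posWeight a₀ (hsDiameter σ N) (N + 1) x) :=
    (measurable_const.mul (measurable_posWeight ha _ _)).ennreal_ofReal
  rw [lintegral_localGibbsMeasure ha hθ hu ha0 hθ0 σ N hG, canonicalPartition_eq_posPartition ha hθ hu ha0 hθ0,
    posGibbsMeasure, lintegral_withDensity_eq_lintegral_mul _ hfm hb.ennreal_ofReal]
  refine lintegral_mono fun q => ?_
  rw [Pi.mul_apply]
  exact mul_le_mul_right (hle q) _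

/-! ### `posGibbsMeasure` and the conditioned product law of the profile -/

/-- **Integration against `posGibbsMeasure`** in the cluster-expansion normalisation:
`∫ F d(posGibbsMeasure a₀ ε_N (N+1)) = Ξ_N(N+1)⁻¹ ∫ F 𝟙[hc] dμ^{⊗(N+1)}`, `μ` the law of `profileOf a₀`. -/
theorem integral_posGibbs_eq (ha : Continuous a₀) (ha0 : ∀ x, 0 < a₀ x) (σ : ℝ) (N : ℕ)
    (F : (Fin (N + 1) → T3) → ℝ) :
    ∫ q, F q ∂posGibbsMeasure a₀ (hsDiameter σ N) (N + 1) =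
      (XiN (profileOf a₀ ha ha0) σ N (N + 1))⁻¹ *
        ∫ q, F q * efR (Ov (hsDiameter σ N)) q univ ∂Measure.pi (fun _ : Fin (N + 1) => (profileOf a₀ ha ha0).μ) := by
  rw [posGibbsMeasure_eq ha ha0, integral_cgibbs_eq (Xi_nonneg _), XiN]

/-- **The expectation of a kernel average under `posGibbsMeasure` is the one-point expectation**
`E_{N+1}[g(q₀)]`. -/
theorem integral_avg_posGibbs_eq_onePt (ha : Continuous a₀) (ha0 : ∀ x, 0 < a₀ x) (σ : ℝ) (N : ℕ)
    {g : T3 → ℝ} (hg : Measurable g) {C : ℝ} (hgC : ∀ y, |g y| ≤ C) :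
    ∫ q, ((((N + 1 : ℕ) : ℝ))⁻¹ * ∑ i, g (q i)) ∂posGibbsMeasure a₀ (hsDiameter σ N) (N + 1) =
      onePt (profileOf a₀ ha ha0) σ g N 0 := by
  rw [integral_posGibbs_eq ha ha0, inv_mul_eq_div]
  exact integral_avg_mul_efR_div hg hgC N

/-- `E_{posGibbs} [(N+1)⁻¹ ∑ g(qᵢ)] ≤ 2M` for a kernel `0 ≤ g ≤ C` of unit mass (small density). -/
theorem integral_avg_posGibbs_le (ha : Continuous a₀) (ha0 : ∀ x, 0 < a₀ x) {σ : ℝ}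
    (hs : SmallDensity (profileOf a₀ ha ha0) σ) (N : ℕ) {g : T3 → ℝ} (hg : Measurable g) {C : ℝ}
    (hg0 : ∀ y, 0 ≤ g y) (hgC : ∀ y, g y ≤ C) (hg1 : ∫ y, g y = 1) :
    ∫ q, ((((N + 1 : ℕ) : ℝ))⁻¹ * ∑ i, g (q i)) ∂posGibbsMeasure a₀ (hsDiameter σ N) (N + 1) ≤
      2 * (profileOf a₀ ha ha0).M := by
  rw [integral_avg_posGibbs_eq_onePt ha ha0 σ N hg (abs_le_of_nonneg_of_le hg0 hgC)]
  exact (onePt_le_two_mul hs hg (abs_le_of_nonneg_of_le hg0 hgC) hg0 (Nat.zero_le N)).trans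
    (by linarith [integral_kernel_μ_le (profileOf a₀ ha ha0) hg hg0 hgC hg1])

/-! ### Averages with weights supported near the centre -/

/-- **Weighted averages of a slowly varying function**: if `χ ≥ 0` and `|f(y) - f₀| ≤ ω` wherever
`χ(y) ≠ 0`, then `|n⁻¹ ∑ χ(qᵢ) f(qᵢ) - c| ≤ ω · n⁻¹∑χ(qᵢ) + |n⁻¹∑χ(qᵢ) - ρ| |f₀|`
with `c = ρ f₀`. -/
theorem abs_avg_mul_sub_le {n : ℕ} {χ f : T3 → ℝ} {f₀ ω ρ : ℝ} (hχ0 : ∀ y, 0 ≤ χ y)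
    (hmod : ∀ y, χ y ≠ 0 → |f y - f₀| ≤ ω) (q : Fin n → T3) :
    |(n : ℝ)⁻¹ * ∑ i, χ (q i) * f (q i) - ρ * f₀| ≤
      ω * ((n : ℝ)⁻¹ * ∑ i, χ (q i)) + |(n : ℝ)⁻¹ * ∑ i, χ (q i) - ρ| * |f₀| := by
  have hn : 0 ≤ (n : ℝ)⁻¹ := inv_nonneg.2 (Nat.cast_nonneg _)
  have h1 : ∑ i, χ (q i) * (f (q i) - f₀) = ∑ i, χ (q i) * f (q i) - (∑ i, χ (q i)) * f₀ := by
    rw [sum_mul, ← sum_sub_distrib]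
    exact sum_congr rfl fun i _ => by ring
  have hsplit : (n : ℝ)⁻¹ * ∑ i, χ (q i) * f (q i) - ρ * f₀ =
      (n : ℝ)⁻¹ * ∑ i, χ (q i) * (f (q i) - f₀) + ((n : ℝ)⁻¹ * ∑ i, χ (q i) - ρ) * f₀ := by
    rw [h1]; ring
  rw [hsplit]
  refine (abs_add_le _ _).trans (add_le_add ?_ (le_of_eq (abs_mul _ _)))
  have hterm : ∀ i, |χ (q i) * (f (q i) - f₀)| ≤ χ (q i) * ω := fun i => by
    rw [abs_mul, abs_of_nonneg (hχ0 _)]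
    by_cases h : χ (q i) = 0
    · rw [h, zero_mul, zero_mul]
    · exact mul_le_mul_of_nonneg_left (hmod _ h) (hχ0 _)
  rw [abs_mul, abs_of_nonneg hn]
  calc (n : ℝ)⁻¹ * |∑ i, χ (q i) * (f (q i) - f₀)| ≤ (n : ℝ)⁻¹ * ∑ i, |χ (q i) * (f (q i) - f₀)| :=
        mul_le_mul_of_nonneg_left (abs_sum_le_sum_abs _ _) hn
    _ ≤ (n : ℝ)⁻¹ * ∑ i, χ (q i) * ω := mul_le_mul_of_nonneg_left (sum_le_sum fun i _ => hterm i) hn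
    _ = ω * ((n : ℝ)⁻¹ * ∑ i, χ (q i)) := by rw [← sum_mul]; ring

/-! ### Measurability of the empirical fields: in the configuration, and jointly with the centre -/

section Measurability

variable {n : ℕ}

/-- The empirical density field against a measurable `χ` is measurable in the configuration. -/
theorem measurable_empiricalDensityField {χ : T3 → ℝ} (hχ : Measurable χ) :
    Measurable fun z : Config n (Fin 3) T3 => empiricalDensityField z χ := by
  simp_rw [empiricalDensityField_eq_sum]
  exact measurable_const.mul (Finset.measurable_sum _ fun i _ => hχ.comp (measurable_pi_apply i).fst)

/-- The empirical momentum field against a measurable `χ` is measurable in the configuration. -/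
theorem measurable_empiricalMomentumField {χ : T3 → ℝ} (hχ : Measurable χ) :
    Measurable fun z : Config n (Fin 3) T3 => empiricalMomentumField z χ := by
  have heq : (fun z : Config n (Fin 3) T3 => empiricalMomentumField z χ) =
      fun z => (n : ℝ)⁻¹ • ∑ i, χ (z i).1 • (z i).2 := by
    funext z; rw [empiricalMomentumField_eq_sum]
  rw [heq]
  have hterm : ∀ i : Fin n, Measurable fun z : Config n (Fin 3) T3 => χ (z i).1 • (z i).2 := fun i =>
    (hχ.comp (measurable_pi_apply i).fst).smul (measurable_pi_apply i).snd
  have hs : Measurable fun z : Config n (Fin 3) T3 => ∑ i, χ (z i).1 • (z i).2 :=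
    Finset.measurable_sum (f := fun i (z : Config n (Fin 3) T3) => χ (z i).1 • (z i).2) univ fun i _ => hterm i
  exact hs.const_smul ((n : ℝ)⁻¹)

/-- The empirical energy field against a measurable `χ` is measurable in the configuration. -/
theorem measurable_empiricalEnergyField {χ : T3 → ℝ} (hχ : Measurable χ) :
    Measurable fun z : Config n (Fin 3) T3 => empiricalEnergyField z χ := by
  simp_rw [empiricalEnergyField_eq_sum]
  exact measurable_const.mul (Finset.measurable_sum _ fun i _ =>
    (hχ.comp (measurable_pi_apply i).fst).mul (((measurable_pi_apply i).snd.norm.pow_const 2).div_const 2))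

variable {k : T3 → T3 → ℝ} (hk : Measurable fun p : T3 × T3 => k p.1 p.2)
include hk

/-- For a jointly measurable kernel `k(x, y)`, `(z, x) ↦ k(x, (z i).1)` is measurable. -/
theorem measurable_kernel_param (i : Fin n) :
    Measurable fun p : Config n (Fin 3) T3 × T3 => k p.2 (p.1 i).1 := by
  have h1 : Measurable fun p : Config n (Fin 3) T3 × T3 => (p.1 i).1 :=
    ((measurable_pi_apply i).comp measurable_fst).fst
  exact hk.comp (measurable_snd.prodMk h1)

/-- The empirical density field against `k(x, ·)` is jointly measurable in `(z, x)`. -/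
theorem measurable_empiricalDensityField_param :
    Measurable fun p : Config n (Fin 3) T3 × T3 => empiricalDensityField p.1 (k p.2) := by
  simp_rw [empiricalDensityField_eq_sum]
  exact measurable_const.mul (Finset.measurable_sum _ fun i _ => measurable_kernel_param hk i)

/-- The empirical momentum field against `k(x, ·)` is jointly measurable in `(z, x)`. -/
theorem measurable_empiricalMomentumField_param :
    Measurable fun p : Config n (Fin 3) T3 × T3 => empiricalMomentumField p.1 (k p.2) := by
  have heq : (fun p : Config n (Fin 3) T3 × T3 => empiricalMomentumField p.1 (k p.2)) =
      fun p => (n : ℝ)⁻¹ • ∑ i, k p.2 (p.1 i).1 • (p.1 i).2 := by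
    funext p; rw [empiricalMomentumField_eq_sum]
  rw [heq]
  have hterm : ∀ i : Fin n, Measurable fun p : Config n (Fin 3) T3 × T3 => k p.2 (p.1 i).1 • (p.1 i).2 := by
    intro i
    have hv : Measurable fun p : Config n (Fin 3) T3 × T3 => (p.1 i).2 :=
      ((measurable_pi_apply i).comp measurable_fst).snd
    exact (measurable_kernel_param hk i).smul hv
  have hs : Measurable fun p : Config n (Fin 3) T3 × T3 => ∑ i, k p.2 (p.1 i).1 • (p.1 i).2 :=
    Finset.measurable_sum (f := fun i (p : Config n (Fin 3) T3 × T3) => k p.2 (p.1 i).1 • (p.1 i).2) univ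
      fun i _ => hterm i
  exact hs.const_smul ((n : ℝ)⁻¹)

/-- The empirical energy field against `k(x, ·)` is jointly measurable in `(z, x)`. -/
theorem measurable_empiricalEnergyField_param :
    Measurable fun p : Config n (Fin 3) T3 × T3 => empiricalEnergyField p.1 (k p.2) := by
  have heq : (fun p : Config n (Fin 3) T3 × T3 => empiricalEnergyField p.1 (k p.2)) =
      fun p => (n : ℝ)⁻¹ * ∑ i, k p.2 (p.1 i).1 * (‖(p.1 i).2‖ ^ 2 / 2) := by
    funext p; rw [empiricalEnergyField_eq_sum]
  rw [heq]
  have hterm : ∀ i : Fin n, Measurable fun p : Config n (Fin 3) T3 × T3 => k p.2 (p.1 i).1 * (‖(p.1 i).2‖ ^ 2 / 2) := by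
    intro i
    have hv : Measurable fun p : Config n (Fin 3) T3 × T3 => (p.1 i).2 :=
      ((measurable_pi_apply i).comp measurable_fst).snd
    exact (measurable_kernel_param hk i).mul ((hv.norm.pow_const 2).div_const 2)
  exact measurable_const.mul (Finset.measurable_sum _ fun i _ => hterm i)

end Measurability

end LGFS
end Summit.AtomisticToContinuum.HydrodynamicLimit.Theorems
end
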